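import Summits.HodgeConjecture.HodgeConjecture.Theses.EndoscopicMiddleDegree
import Literature.AlgebraicGeometry.ShimuraVarieties.HeckeCorrespondenceAction
import Summits.HodgeConjecture.HodgeConjecture.Theorems.EndoscopicMiddleDegreeAlgebraicOrEnvelopedStubHeckeGraphAlgebraic
import Summits.HodgeConjecture.HodgeConjecture.Theorems.EndoscopicMiddleDegreeIsotypicMiddleClassesAlgebraicStubCorrActionAlgebraic

/-!
# Crux `IsotypicMiddleClassesAlgebraic` (stmt-HodgeConjecture-14301), line `hecke-generation`:
# stub S2 `stub_saturatedThetaWorldAlgebraic` — the Hecke-saturated theta world is algebraic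

For `μ` an orientation family with Poincaré duality, `m ∈ {1, 2}` (`dim X = 2n`, `n = m + 1`), a
datum `D : UnitaryBallQuotientDatum (2n) X`, granted the route support `CupProductAlgebraic` and the
Hodge conjecture of `X` in degree `2m` (`hlow`): the HECKE SATURATION
`TWH(D) = span {a w : a ∈ 𝓗(D), w ∈ TW(D)}` of the theta world
`TW(D) = SCⁿ(D) ⊔ SCon(D) ⊔ span {a ∪ d : a ∈ Hdg^{m,m}_ℚ, d ∈ N¹}` by the Hecke algebra
`𝓗(D) = ℂ⟨T_g⟩ ⊆ End H^{2n}(X(ℂ); ℂ)` lies in `Nⁿ H^{2n}(X(ℂ); ℂ) = algebraicClasses X n`: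

* `TW(D) ≤ Alg`: special-cycle classes and cycles on special cycles are supported in codimension `n`
  (`classesSupportedOn_le_supportedClasses` with the datum's `isClosed_specialSubvariety` /
  `le_coheight_of_mem_specialSubvariety`, as in the landed `algebraicOrEnvelopedOfSplit_proof`); the
  Lefschetz summand `a ∪ d` by `hlow` and `CupProductAlgebraic`;
* `𝓗(D) · Alg ⊆ Alg` by `Algebra.adjoin_induction`: each Hecke operator is the action of an
  ALGEBRAIC self-correspondence (`CoreSplittingLadder.stub_heckeGraphAlgebraic`, landed) and such actions
  preserve algebraic classes (`stub_corrActionAlgebraic`, landed); sums, products and scalars are clear.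

The statement is the REGISTERED stub verbatim; the line's vocabulary `heckeSaturatedThetaWorld`
(with `heckeAlgebra`, `thetaWorld` inlined) is displayed by a local notation expanding to the
skeleton's definitions (`Cruxes/IsotypicMiddleClassesAlgebraic/Lines/hecke_generation.lean`), so nothing
is defined here.  No definition, no named-fact hypothesis, no sorry.
-/

set_option linter.dupNamespace false

noncomputable section

open CategoryTheory MonoidalCategory CartesianMonoidalCategory
open Literature.AlgebraicGeometry Literature.AlgebraicGeometry.HodgeTheory
open Literature.AlgebraicGeometry.Motives
open Literature.AlgebraicGeometry.ShimuraVarieties Literature.AlgebraicTopology.SingularHomology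
open Summit.HodgeConjecture.HodgeConjecture.Theses

namespace Summit.HodgeConjecture.HodgeConjecture.Theorems.IsotypicMiddleClassesAlgebraic

/-- `heckeSaturatedThetaWorld m X D` — the skeleton's HECKE SATURATION `TWH(D) = 𝓗(D) · TW(D)` of the
theta world, verbatim (`heckeAlgebra D = Algebra.adjoin ℂ (range T_g)` and the three summands of
`thetaWorld m X D` inlined; display only, nothing is defined). -/
local notation3 "heckeSaturatedThetaWorld " m:max X:max D:max =>
  Submodule.span ℂ {x : complexBetti X (2 * (m + 1)) |
    ∃ a ∈ Algebra.adjoin ℂ (Set.range ((D : UnitaryBallQuotientDatum (2 * (m + 1)) X).heckeCorrespondenceAction (2 * (m + 1)))),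
      ∃ w ∈ ((⨆ (W : Submodule (D : UnitaryBallQuotientDatum (2 * (m + 1)) X).E (Fin (2 * (m + 1) + 1) → (D : UnitaryBallQuotientDatum (2 * (m + 1)) X).E))
            (_ : IsTotallyPositive (conjRingHom (D : UnitaryBallQuotientDatum (2 * (m + 1)) X).E) (D : UnitaryBallQuotientDatum (2 * (m + 1)) X).H W)
            (_ : Module.finrank (D : UnitaryBallQuotientDatum (2 * (m + 1)) X).E W = m + 1),
            classesSupportedOn X ((D : UnitaryBallQuotientDatum (2 * (m + 1)) X).specialSubvariety W) (2 * (m + 1))) ⊔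
          (⨆ (W : Submodule (D : UnitaryBallQuotientDatum (2 * (m + 1)) X).E (Fin (2 * (m + 1) + 1) → (D : UnitaryBallQuotientDatum (2 * (m + 1)) X).E))
            (_ : IsTotallyPositive (conjRingHom (D : UnitaryBallQuotientDatum (2 * (m + 1)) X).E) (D : UnitaryBallQuotientDatum (2 * (m + 1)) X).H W)
            (_ : Module.finrank (D : UnitaryBallQuotientDatum (2 * (m + 1)) X).E W = m)
            (Z : Set (X : SchemeOver ℂ).left) (_ : IsClosed Z) (_ : Z ⊆ (D : UnitaryBallQuotientDatum (2 * (m + 1)) X).specialSubvariety W)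
            (_ : ∀ z ∈ Z, ((m + 1 : ℕ) : ℕ∞) ≤ Order.coheight z),
            classesSupportedOn X Z (2 * (m + 1))) ⊔
          Submodule.span ℂ {z : complexBetti X (2 * (m + 1)) | ∃ a : complexBetti X (2 * m),
            IsRationalClass a ∧ IsOfHodgeType (2 * (m + 1)) X (2 * m) m m a ∧
            ∃ d ∈ algebraicClasses X 1, z = cupProduct (two_mul_add_two_mul m 1) a d} :
          Submodule ℂ (complexBetti X (2 * (m + 1)))),
        x = a w}

/-- **The Hecke algebra preserves algebraic classes** (`dim X = 2n`, `n = m + 1`, `m ∈ {1,2}`): every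
element of `𝓗(D) = ℂ⟨T_g⟩` maps `Nⁿ H^{2n}(X(ℂ); ℂ)` into itself — generators by
`stub_heckeGraphAlgebraic` (`T_g = P_γ`, `γ` algebraic) and `stub_corrActionAlgebraic` (granted
`CupProductAlgebraic`), then `Algebra.adjoin_induction`.
[cite: BergeronMillsonMoeglin2016Balls, Part 2 §1.8 and Thm. 61] -/
theorem heckeAlgebra_mapsTo_algebraicClasses (h9 : EndoscopicMiddleDegree.CupProductAlgebraic)
    (μ : OrientationFamily) (hμ : μ.HasPoincareDuality) (m : ℕ) (X : SchemeOver ℂ)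
    (D : UnitaryBallQuotientDatum (2 * (m + 1)) X) (h1 : 1 ≤ m) (h2 : m ≤ 2)
    {a : Module.End ℂ (complexBetti X (2 * (m + 1)))}
    (ha : a ∈ Algebra.adjoin ℂ (Set.range (D.heckeCorrespondenceAction (2 * (m + 1))))) :
    ∀ w ∈ algebraicClasses X (m + 1), a w ∈ algebraicClasses X (m + 1) := by
  induction ha using Algebra.adjoin_induction with
  | mem a ha' =>
    obtain ⟨g, rfl⟩ := ha'
    intro w hw
    obtain ⟨γ, hγ, hγT⟩ := CoreSplittingLadder.stub_heckeGraphAlgebraic μ hμ m X D h1 h2 g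
    rw [← hγT]
    exact stub_corrActionAlgebraic h9 μ hμ m X D.isSmoothProjective γ hγ w hw
  | algebraMap r =>
    intro w hw
    rw [Module.algebraMap_end_apply]
    exact Submodule.smul_mem _ _ hw
  | add a b _ _ iha ihb =>
    intro w hw
    rw [LinearMap.add_apply]
    exact add_mem (iha w hw) (ihb w hw)
  | mul a b _ _ iha ihb =>
    intro w hw
    rw [Module.End.mul_apply]
    exact iha _ (ihb w hw)

/-- **Stub S2 `stub_saturatedThetaWorldAlgebraic`** (crux `IsotypicMiddleClassesAlgebraic`,
stmt-HodgeConjecture-14301, line `hecke-generation`; REGISTERED signature, verbatim): granted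
`CupProductAlgebraic` and the Hodge conjecture of `X` in degree `2m`, the Hecke-saturated theta world
`TWH(D)` lies in `algebraicClasses X (m + 1)` — the theta world is algebraic summand by summand
(special cycles / cycles on special cycles by support and codimension, the Lefschetz summand by `hlow`
and `CupProductAlgebraic`) and the Hecke algebra preserves algebraic classes
(`heckeAlgebra_mapsTo_algebraicClasses`). [cite: BergeronMillsonMoeglin2016Balls, Part 2 §1.8 and Thm. 61]
[cite: VoisinHodgeII2003, §9.2.4 Prop. 9.20] -/
theorem stub_saturatedThetaWorldAlgebraic (h9 : EndoscopicMiddleDegree.CupProductAlgebraic)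
    (μ : OrientationFamily) (hμ : μ.HasPoincareDuality)
    (m : ℕ) (X : SchemeOver ℂ) (D : UnitaryBallQuotientDatum (2 * (m + 1)) X) (h1 : 1 ≤ m) (h2 : m ≤ 2)
    (hlow : ∀ a : complexBetti X (2 * m), IsRationalClass a →
        IsOfHodgeType (2 * (m + 1)) X (2 * m) m m a → a ∈ algebraicClasses X m) :
    heckeSaturatedThetaWorld m X D ≤ algebraicClasses X (m + 1) := by
  have hX : IsSmoothProjective (2 * (m + 1)) X := D.isSmoothProjective
  refine Submodule.span_le.2 ?_
  rintro x ⟨a, ha, w, hw, rfl⟩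
  refine heckeAlgebra_mapsTo_algebraicClasses h9 μ hμ m X D h1 h2 ha w ?_
  -- the theta world is algebraic, summand by summand
  refine SetLike.le_def.1 (sup_le (sup_le ?_ ?_) ?_) hw
  · -- (1) special cycles of codimension `m + 1`
    refine iSup_le fun W ↦ iSup_le fun hW ↦ iSup_le fun hk ↦
      classesSupportedOn_le_supportedClasses (D.isClosed_specialSubvariety W hW) (fun z hz ↦ ?_) _
    have := D.le_coheight_of_mem_specialSubvariety W hW z hz
    rw [hk] at this
    exact_mod_cast this
  · -- (2) codimension-`(m+1)` cycles on the codimension-`m` special cycles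
    exact iSup_le fun _ ↦ iSup_le fun _ ↦ iSup_le fun _ ↦ iSup_le fun _ ↦ iSup_le fun hZ ↦
      iSup_le fun _ ↦ iSup_le fun hk ↦ classesSupportedOn_le_supportedClasses hZ hk _
  · -- (3) the Lefschetz summand: HC in degree `2m` (`hlow`) and `CupProductAlgebraic`
    refine Submodule.span_le.2 ?_
    rintro z ⟨a, ha, haH, d, hd, rfl⟩
    exact h9 hX m 1 a d (hlow a ha haH) hd

end Summit.HodgeConjecture.HodgeConjecture.Theorems.IsotypicMiddleClassesAlgebraic

end
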